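import Literature.AnabelianGeometry.EtaleTheta.Discharge.Sec4NonVacuityConstants
import Literature.AnabelianGeometry.EtaleTheta.Discharge.Sec4NonVacuityCoveringRoots
import Literature.AlgebraicGeometry.Frobenioids.ModelFrobenioidBaseSection
import HarnessLib

/-!
# [EtTh] Prop. 4.2 (iv), sub-node L05 `UnitRootsUpstairs` FAILS at the toy with constants `ℤˣ = {±1}`:
# the roots-of-constants input (GAP-LEDGER G-w4d044-1) is NOT a consequence of the typed §4 setting data

S. Mochizuki, *The étale theta function and its Frobenioid-theoretic manifestations*, Publ. RIMS **45**
(2009) [MochizukiEtTh2009], §4, Prop. 4.2 (iv), proof PDF p.90 L14–17 (printed p.316): «it follows from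
the "(N, H_⊙, f|_{A_N})-saturated-ness" condition in the statement of assertion (iii) [cf. also Proposition
3.4, (ii)] that the pull-back `∈ O^×(A_N)` … of any element `∈ O^×(A_⊙)` … admits an `N`-th root» — typed as
the sub-node L05 `BiKummerSetting.Prop42Sub.UnitRootsUpstairs` of `plan/L2/SUBDAG-EtTh-Prop42.md`
(FACT-LIST row **F-2798**; abc-iut cell, block F, seat abc-iut-f-130, tranche 130).

PROOF-ONLY sequel (0 `def`s) of `Sec4NonVacuityConstants.lean` (the Kummer-tower toy of abc-iut-w5-d063
with an arbitrary constant group `C`).  AT `C := ℤˣ = {±1}` with the vacuous `(N,H)`-slot of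
`mkOfModelCanonical`:
* `ToyCst.isMuSaturated_two_int` — every object is `μ_2`-SATURATED (REAL [FrdII] Def. 2.1 (i): `μ_2(A) =
  {±1}` is cyclic of order `2`, generated by `-1`);
* `ToyCst.exists_baseFrobeniusTypeData_zeroFrob` (any `C`, any `N` with `A_⊙` `μ_N`-saturated) — GENUINE data
  of base-Frobenius type for the Frobenius endomorphism `α = (N, id, 0, 1)` of `A_⊙` with pull-back part
  `α' = 𝟙` and `G = 1`, arising from L1's zero base-Frobenius pair (`ModelFrobenioid.isBaseFrobeniusPair_zero`,
  REAL [FrdI] Def. 2.7 (iii));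
* `ToyCst.not_unitRootsUpstairs_int` — **L05 is FALSE at `ToyCst.biKummerSetting ℤˣ` with the model
  transport**: the genuine square root `R` of the fraction-pair `(𝟙, 𝟙)` of `f = 1` (`N = 2`, `A_N = B_N = A_⊙`,
  `α = β = (2, id, 0, 1)`, root `1`, `A_⊙` `(2, H_⊙, 1)`-saturated) has the unit `x' = -1 ∈ O^×(A_N)` over
  `x = -1 ∈ O^×(A_⊙)` along `α' = 𝟙`, and `-1` is not a square in `O^×(A_N) = {±1}`;
* `ToyCst.not_forall_unitRootsUpstairs` — hence **the universal closure of F-2798 over the §4 settings (of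
  this type signature) and transports is FALSE**.

READING (neutral).  With abc-iut-w5-d063's `ToyCov.unitRootsUpstairs` (L05 HOLDS at `C = ℂˣ`, divisible)
this is an INDEPENDENCE certificate: over the typed `BiKummerSetting` data through `mkOfModelCanonical`
(Frobenioid structure, Frobenius-trivial / Galois / `μ_N`-saturated `A_⊙`, genuine base-Frobenius pairs,
genuine `N`-th roots, vacuous `(N,H)`-slot), L05 is decided by the arithmetic of the constants — exactly the
«roots of constants» law `hL` of abc-iut-w4-d044's `unitRootsUpstairs_of_constantRoots` (GAP-LEDGER
G-w4d044-1: the `(N, H_⊙^{bs-fld})`-saturation content of [FrdII] Def. 2.2 (ii)(c) + [EtTh] Prop. 3.4 (ii)),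
which the typed setting carries only through its FREE `(N,H)`-slot.  So F-2798 is a SCHEMA: instance
PROVED at the roots reading (`Prop42Sub.unitRootsUpstairs_holds`, p433432) and at `ToyCov`; universal
closure REFUTED here.  Nothing in print is refuted (print's `A_N` IS `(N, H_⊙)`-saturated in the genuine
`C^{bs-fld}`).  HONEST LIMITS: one base object, trivial [FrdI] vocabularies, `Π^tp` trivial over `ℚ̄`,
not a curve; consistency ≠ faithfulness; typed ≠ proved.  Nothing here bears on, or takes a side on,
[IUTchIII] Cor. 3.12.
-/

noncomputable section

namespace Literature.AnabelianGeometry.EtaleTheta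

open CategoryTheory Opposite Literature.AlgebraicGeometry.Frobenioids
open scoped NNRat

namespace ToyCst

open ToyCov (Base pt deg cover hom_eq aut_eq_one powFunctor catVocab)

section Generic

variable (C : Type) [CommGroup C]

/-- **Genuine data of base-Frobenius type for the Frobenius endomorphism `α = (N, id, 0, 1)` of `A_⊙`**
(pull-back part `α' = 𝟙`, `G = 1`), at the toy with constants `C`, as soon as `A_⊙` is `μ_N`-saturated:
(a) REAL, (b)–(d) trivial/L1, (e) REAL [FrdI] Def. 2.7 (iii) via L1's zero base-Frobenius pair
(`ModelFrobenioid.isBaseFrobeniusPair_zero`). [cite: MochizukiEtTh2009, Def 4.1 p.87] -/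
theorem exists_baseFrobeniusTypeData_zeroFrob (N : ℕ+)
    (hμ : (temperedFrobenioid C).IsMuSaturated (Aodot C) N) :
    ∃ d : (biKummerSetting C).BaseFrobeniusTypeData (ModelFrobenioid.zeroFrob (Aodot C) rfl N),
      d.α₁ = 𝟙 _ ∧ d.G = ⊥ :=
  ⟨{ G := ⊥
     G_le := bot_le
     α₂ := ModelFrobenioid.zeroFrob (Aodot C) rfl N
     α₁ := 𝟙 _
     fac := Category.comp_id _
     isFrobeniusTrivial := isFrobeniusTrivial_Aodot C
     isGalois := trivial
     isMuSaturated := hμ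
     mapsIsomorphically := by
       refine ⟨fun σ hσ => ?_, fun σ hσ τ hτ _ => ?_, fun τ _ => ⟨1, (⊥ : Subgroup (Aut (Aodot C))).one_mem, ?_⟩⟩
       · have hσ' : σ = 1 := hσ
         subst hσ'
         rw [map_one]
         exact one_mem _
       · exact (show σ = 1 from ‹σ ∈ ((⊥ : Subgroup (Aut (Aodot C))) : Set (Aut (Aodot C)))›).trans
           (show τ = 1 from ‹τ ∈ ((⊥ : Subgroup (Aut (Aodot C))) : Set (Aut (Aodot C)))›).symm
       · rw [map_one]
         exact (aut_eq_one _ τ).symm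
     cond_c := ⟨rfl, ⟨ModelFrobenioid.isCoAngular (ratFnFunctor_isGroupLike C) _, rfl⟩,
       show IsIso (𝟙 (ModelFrobenioid.base (Aodot C))) from inferInstance⟩
     cond_d := ModelFrobenioid.isPullbackMorphism_of (divisorMonoid_isDivisorial C) (ratFnFunctor_isGroupLike C)
       rfl rfl
     cond_e := by
       refine ⟨ModelFrobenioid.zeroPresection _ _ _, ModelFrobenioid.zeroFrobeniusSection _ _ _,
         ModelFrobenioid.isBaseFrobeniusPair_zero (divisorMonoid_isDivisorial C) (ratFnFunctor_isGroupLike C)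
           (fun X Y _ => Subsingleton.elim X Y),
         fun γ hγ => ?_, ⟨rfl, rfl, rfl, rfl, rfl⟩, ⟨rfl, N, rfl⟩⟩
       have hγ' : γ = 1 := hγ
       subst hγ'
       exact ⟨rfl, rfl, rfl, rfl, rfl⟩ }, rfl, rfl⟩

/-- `A_⊙ = (∗, 0)` is `H_⊙`-ample (`Aut_D(∗) = 1`). [cite: MochizukiEtTh2009, Def 4.1 p.87] -/
theorem isAmple_Aodot : (biKummerSetting C).IsAmple (Aodot C) :=
  ⟨trivial, fun σ _ => ⟨1, by rw [map_one, aut_eq_one _ σ]⟩⟩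

/-- The fraction `𝟙 · 𝟙⁻¹` of the pair `(𝟙, 𝟙)` is `1` (in the model: `u_𝟙 · u_𝟙⁻¹`).
[cite: MochizukiEtTh2009, Def 4.1 p.86] -/
theorem fracOf_id_id (A : (biKummerSetting C).C) :
    (biKummerSetting C).fracOf (𝟙 A) (𝟙 A) (ModelFrobenioid.isPreStep_id A) (ModelFrobenioid.isPreStep_id A)
      rfl = 1 := by
  change (temperedFrobenioid C).fracOfModel (realified C).isUnit_BΛ (𝟙 A) (𝟙 A) = 1
  rw [TemperedFrobenioid.fracOfModel, ModelFrobenioid.frac]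
  exact div_self' _

end Generic

/-! ## `C := ℤˣ`: `μ_2`-saturated, but `-1` has no square root -/

/-- `-1 ∈ ℤˣ` has order `2` and generates the `2`-torsion (all of `ℤˣ`). [folklore] -/
private theorem orderOf_neg_one_int : orderOf (-1 : ℤˣ) = ((2 : ℕ+) : ℕ) :=
  (orderOf_eq_prime (p := 2) (by decide) (by decide)).trans rfl

/-- **Every object of the toy with constants `ℤˣ` is `μ_2`-saturated** (REAL [FrdII] Def. 2.1 (i)): `μ_2(A) =
O^×(A) = {±1}` is cyclic of order `2`, generated by multiplication by `-1`. [cite: MochizukiEtTh2009, Def 4.1 p.87] -/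
theorem isMuSaturated_two_int (A : (temperedFrobenioid ℤˣ).category) :
    (temperedFrobenioid ℤˣ).IsMuSaturated A 2 :=
  isMuSaturated_of_generator A 2 (-1) orderOf_neg_one_int fun c _ => by
    rcases Int.units_eq_one_or c with rfl | rfl
    · exact one_mem _
    · exact Subgroup.mem_zpowers _

/-- **L05 `UnitRootsUpstairs` is FALSE at the toy with constants `ℤˣ`** (model transport, vacuous
`(N,H)`-slot).  The fraction-pair `(𝟙, 𝟙) : A_⊙ → A_⊙` of `f = 1` has the genuine square root
`R = (A_N := A_⊙, B_N := A_⊙, α = β := (2, id, 0, 1), root 1, pair (𝟙, 𝟙))` — `α` of base-Frobenius type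
with `α' = 𝟙` (`exists_baseFrobeniusTypeData_zeroFrob`, `μ_2`-saturation REAL), `A_⊙` `(2, H_⊙, 1)`-saturated
— and the unit `x' := -1` of `A_N` lies over the unit `x := -1` of `A_⊙` along `α' = 𝟙`; a square root
`y ∈ O^×(A_N) = {±1}` of `-1` would give `c² = -1` in `ℤˣ`. [cite: MochizukiEtTh2009, Prop 4.2 p.90] -/
theorem not_unitRootsUpstairs_int :
    ¬ BiKummerSetting.Prop42Sub.UnitRootsUpstairs (biKummerSetting ℤˣ)
        (fun φ x => (temperedFrobenioid ℤˣ).pullFracModel φ x) := by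
  intro h
  obtain ⟨d, hd1, -⟩ := exists_baseFrobeniusTypeData_zeroFrob ℤˣ 2 (isMuSaturated_two_int (Aodot ℤˣ))
  -- the fraction-pair `(𝟙, 𝟙)` of `f = 1`
  have hsharp : ∀ x : (temperedFrobenioid ℤˣ).Φ.carrier (op (Aodot ℤˣ).base),
      x ∣ (1 : (temperedFrobenioid ℤˣ).Φ.carrier (op (Aodot ℤˣ).base)) → x = 1 := fun x hx =>
    (divisorMonoid_isDivisorial ℤˣ (Aodot ℤˣ).base).isSharp.eq_one_of_isUnit x (isUnit_of_dvd_one hx)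
  let P : (biKummerSetting ℤˣ).FractionPair (1 : (biKummerSetting ℤˣ).biratUnits (Aodot ℤˣ)) (Aodot ℤˣ) :=
    { num := 𝟙 _
      den := 𝟙 _
      isPreStep_num := ModelFrobenioid.isPreStep_id _
      isPreStep_den := ModelFrobenioid.isPreStep_id _
      base_eq := rfl
      frac_eq := fracOf_id_id ℤˣ (Aodot ℤˣ)
      disjointSupports := fun x hx _ => hsharp x hx }
  -- its genuine square root, upstairs = downstairs
  let R : (biKummerSetting ℤˣ).NthRoot (1 : (biKummerSetting ℤˣ).biratUnits (Aodot ℤˣ)) P 2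
      (fun φ x => (temperedFrobenioid ℤˣ).pullFracModel φ x) :=
    { AN := Aodot ℤˣ
      BN := Aodot ℤˣ
      α := ModelFrobenioid.zeroFrob (Aodot ℤˣ) rfl 2
      β := ModelFrobenioid.zeroFrob (Aodot ℤˣ) rfl 2
      root := 1
      pair := P
      comm_num := (Category.id_comp _).trans (Category.comp_id _).symm
      comm_den := (Category.id_comp _).trans (Category.comp_id _).symm
      isIsometry := ⟨rfl, rfl, rfl, rfl⟩
      αData := d
      pow_root := by rw [one_pow]; exact (map_one _).symm
      isSaturated :=
        { isAmple := isAmple_Aodot ℤˣ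
          fixed := fun σ _ => by
            change (temperedFrobenioid ℤˣ).biratAutModel (Aodot ℤˣ) σ
              ((temperedFrobenioid ℤˣ).pullFracModel d.α₁ 1) = (temperedFrobenioid ℤˣ).pullFracModel d.α₁ 1
            rw [(temperedFrobenioid ℤˣ).biratAutModel_eq_one_of_mem_units
              ⟨(mem_units (Aodot ℤˣ) σ).1, (mem_units (Aodot ℤˣ) σ).2⟩]
            rfl
          cond_a := ⟨Aodot ℤˣ, Aodot ℤˣ, 𝟙 _, 𝟙 _, ModelFrobenioid.isPreStep_id _,
            ModelFrobenioid.isPreStep_id _, isFrobeniusTrivial_Aodot ℤˣ, trivial⟩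
          cond_b := ⟨1, by rw [one_pow]; exact (map_one _).symm⟩ } }
  -- the unit `-1` upstairs lies over the unit `-1` downstairs along `α' = 𝟙`
  have hu : coefAut (Aodot ℤˣ) (-1) ∈ (biKummerSetting ℤˣ).units (Aodot ℤˣ) :=
    ⟨(coefAut_mem_units (Aodot ℤˣ) (-1)).1, (coefAut_mem_units (Aodot ℤˣ) (-1)).2⟩
  have hover : (coefAut (Aodot ℤˣ) (-1)).hom ≫ R.αData.α₁ = R.αData.α₁ ≫ (coefAut (Aodot ℤˣ) (-1)).hom := by
    change (coefAut (Aodot ℤˣ) (-1)).hom ≫ d.α₁ = d.α₁ ≫ (coefAut (Aodot ℤˣ) (-1)).hom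
    rw [hd1]
    exact (Category.comp_id _).trans (Category.id_comp _).symm
  obtain ⟨y, hy, hyy⟩ := h 1 P 2 R (coefAut (Aodot ℤˣ) (-1)) (coefAut (Aodot ℤˣ) (-1)) hu hu hover
  -- `y = c` for a constant `c ∈ ℤˣ`, and `c² = -1` is absurd
  obtain ⟨c, rfl⟩ := exists_eq_coefAut (Aodot ℤˣ) ⟨hy.1, hy.2⟩
  have hsq : coefUnit (Aodot ℤˣ) c ^ ((2 : ℕ+) : ℕ) = coefUnit (Aodot ℤˣ) (-1) :=
    Subtype.ext (by rw [SubmonoidClass.coe_pow]; exact hyy)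
  have key := congrArg (ModelFrobenioid.unitsToRatFn (Aodot ℤˣ)) hsq
  rw [map_pow, unitsToRatFn_coefUnit, unitsToRatFn_coefUnit, ← map_pow] at key
  have hc : c ^ ((2 : ℕ+) : ℕ) = -1 := cnstUnitHom_injective (Aodot ℤˣ) key
  have hc1 : c ^ ((2 : ℕ+) : ℕ) = 1 := Int.units_sq c
  exact absurd (hc.symm.trans hc1) (by decide)

/-- **F-2798 · the universal closure of L05 `UnitRootsUpstairs` is FALSE**: over the §4 settings of the toy's
type signature (`Π^tp` trivial over `ℚ̄`, Kummer-tower base, constants `ℤˣ`) and all transports, L05 fails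
somewhere — at `ToyCst.biKummerSetting ℤˣ` with the model transport (`not_unitRootsUpstairs_int`).  With
`ToyCov.unitRootsUpstairs` (HOLDS at constants `ℂˣ`): L05 is independent of the typed §4 setting data; its
content is the roots-of-constants law (GAP-LEDGER G-w4d044-1). [cite: MochizukiEtTh2009, Prop 4.2 p.90] -/
theorem not_forall_unitRootsUpstairs :
    ¬ ∀ (S : BiKummerSetting Toy.temperedGroup (realified ℤˣ) Base catVocab)
        (pullFrac : ∀ {A A' : S.C} (_ : A' ⟶ A), S.biratUnits A → S.biratUnits A'),
      BiKummerSetting.Prop42Sub.UnitRootsUpstairs S pullFrac :=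
  fun h => not_unitRootsUpstairs_int (h (biKummerSetting ℤˣ) fun φ x => (temperedFrobenioid ℤˣ).pullFracModel φ x)

/-- **L05 is INDEPENDENT of the typed §4 setting data** (packaging): it FAILS at constants `ℤˣ`
(`not_unitRootsUpstairs_int`) and HOLDS at constants `ℂˣ` (abc-iut-w5-d063's `ToyCov.unitRootsUpstairs`),
both through `mkOfModelCanonical` with the vacuous `(N,H)`-slot and the model transport.
[cite: MochizukiEtTh2009, Prop 4.2 p.90] -/
theorem unitRootsUpstairs_independent :
    ¬ BiKummerSetting.Prop42Sub.UnitRootsUpstairs (biKummerSetting ℤˣ)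
        (fun φ x => (temperedFrobenioid ℤˣ).pullFracModel φ x) ∧
      BiKummerSetting.Prop42Sub.UnitRootsUpstairs ToyCov.biKummerSetting
        (fun φ x => ToyCov.temperedFrobenioid.pullFracModel φ x) :=
  ⟨not_unitRootsUpstairs_int, ToyCov.unitRootsUpstairs⟩

end ToyCst

end Literature.AnabelianGeometry.EtaleTheta

end
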